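import Summits.QuantumFields.YangMills.Theorems.UnitScaleTiltProp7NestedMeanParallelLiftParSplit
import Summits.QuantumFields.YangMills.Theorems.UnitScaleTiltProp7NestedMeanParallelLiftConst
import HarnessLib

/-!
# Route `UnitScaleTilt`, crux K1 child «MinimiserStabilityRegPr» (stmt-QuantumFields-19200), stub `stub_existenceMinimalOrbit` (EX), line «SYM-CENTRE»
# (★★OWNER RULING g28-№7 cure (ii-a); px20 g2 LOCATE #56, (R4) assembly plan 22:30:05Z) — **THE SECOND SPLIT, INSIDE THE DIAGONAL STRATUM: for a
# σ₃-DIAGONAL coarse field EITHER every parallel section is a constant diagonal matrix (the genuinely abelian case `p = 1`, the input shape of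
# ✓`hLift_of_parallelConstCommuting`) OR all closed-walk holonomies at some site are central (`p = 3` in diagonal disguise — e.g. a diagonal pure gauge
# times a `ℤ₂` twist — the input of the «Z2-NORMAL-FORM» `exists_gauge_centralValued_of_loopHol_central`)**

Cell `ym3-torus`, width seat `ym3-torus-px6` (gen 3).  THEOREMS ONLY (0 `def`, 0 `sorry`).  `--supports stmt-QuantumFields-19200 --as helper`, count-neutral.
YM₃ on T³ is a ladder rung (R3), not the Clay problem; nothing here claims the stub, the crux, d = 4 or the mass gap.

THE POINT (a located hazard of the (R4) plan and its cure).  After the σ₃-diagonalising gauge (✓`exists_gauge_commute_sigma3_of_parallel`) the coarse field `V′`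
is diagonal, but «diagonal» does NOT imply «`Par_{V′} ∩ 𝔰𝔲(2) = ℝσ₃`»: a diagonal field all of whose HOLONOMIES are central (while its bond VALUES need not be)
has a four-dimensional space of parallel sections, and then the abelian lift's `hLift` cannot come from ✓`hLift_of_parallelConstCommuting`.  The dichotomy
here separates the two cases by kernel: (A) every `V′♭`-parallel section commutes with `σ₃` pointwise — then it is CONSTANT (a diagonal bond variable and a
diagonal value commute), which is exactly the `hPar` shape; (B) some parallel section is non-diagonal at some `y₀` — then every closed-walk holonomy `H` at
`y₀` is diagonal (product of diagonal bond variables) AND commutes with that non-diagonal value (parallel transport around the loop fixes it), hence is a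
scalar, hence central: the `hcen` datum of the Z2-NORMAL-FORM (w2-19936 g9), after which ✓`exists_symCentre_of_central_gauge` serves.
* §1 (2×2) `apply01_eq_zero_of_commute_sigma3`∕`apply10_…` (commuting with `σ₃` = diagonal), `commute_of_commute_sigma3` (two such commute),
  ★`central_of_commute_sigma3_of_commute` (diagonal + commuting with a non-diagonal matrix ⇒ central), `star_sigma3`.
* §2 (generic `P`, level 0, `SU(2)`) `coe_holAt_walk_commute` (holonomies of a diagonal field are diagonal), ★★`parallel_transport_walk` (`c(x) = H·c(end)·H⋆`
  along every walk), ★`parallel_const_of_commute_sigma3` (case A ⇒ constant), ★★`loopHol_central_of_parallel_nondiag` (case B ⇒ `hcen` at `y₀`),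
  ★★★`parallelConstDiag_or_loopHol_central` (the dichotomy).
* §3 (T³) ★★`hLift_of_mem_fibre_of_parallelConstDiag` — the fine-level bridge: `U₁ ∈ fibre V′`, `RegPr ε₀ U₁` (`10⁷L³ε₀ ≤ 1`), `U₁` diagonal-valued, `V′` in
  case A ⇒ `hLift U₁` (✓`hLift_of_parallelConstCommuting` through ✓`descendTo_eq_fieldShift_emlIterU_of_regPr`).
HONEST SCOPE.  Linear algebra and bookkeeping; no estimate; no stub ∕ crux statement is advanced; the abelian lift (R3)∕(R4) is the line's content.

References: T. Bałaban, CMP 99 (1985) 389–434 [Balaban1985BackgroundPropagators] ((3.19)–(3.21) pp.393–394); CMP 98 (1985) 17–51 [Balaban1985Averaging] ((8)–(11) p.19);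
CMP 102 (1985) 277–309 [Balaban1985Variational] ((3)–(6) p.278).
-/

set_option autoImplicit false

noncomputable section

open scoped BigOperators Matrix.Norms.L2Operator Matrix

namespace Summit.QuantumFields.YangMills.Theorems.Prop7NestedMeanParallelLiftDiagGauge

open Literature.MathematicalPhysics.QuantumFieldTheory.Balaban1983to89
open T4Continuum BlockAveraging
open B10Eq27TorusAxialLog (unitsField toUField)
open B15DeterminingSets (embIter)
open B9AdOrthogonal (σ₃)
open Summit.QuantumFields.YangMills.Theorems.Prop8Chart (emlIterU)
open Summit.QuantumFields.YangMills.BalabanUVNodes.N12FlatFibreNullSpace (const_of_shift_eq)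
open B5Positivity172Lattice (TT ofT)
open Literature.MathematicalPhysics.QuantumFieldTheory.Balaban1983to89.T3ContinuumYM3Torus
open T3UnitLawDensityEML (ℰp)
open T3TiltDescent (descendTo)
open T3ConstrainedMinimiser (fibre)
open T3PrintedRegularMinimiser (RegPr)
open T3SectALandauChart (bgUnits)
open T3LevelShift (siteShift bondShift fieldShift fieldShift_apply bondShift_src bondShift_tgt)
open Prop7SymAvgGLSmallOfRegPr (descendTo_eq_fieldShift_emlIterU_of_regPr)
open Summit.QuantumFields.YangMills.Theorems.Prop7NestedMeanParallelLift (hLift_of_parallelConstCommuting)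

/-! ## §1 `2 × 2` letters: commuting with `σ₃` -/

section Matrices

/-- A matrix commuting with `σ₃` has vanishing `(0,1)` entry. [folklore] -/
theorem apply01_eq_zero_of_commute_sigma3 {A : Matrix (Fin 2) (Fin 2) ℂ} (hA : Commute A σ₃) : A 0 1 = 0 := by
  have h := congrFun (congrFun hA.eq 0) 1
  rw [sigma3_eq] at h
  simp [Matrix.mul_apply, Fin.sum_univ_two] at h
  linear_combination (-(1 : ℂ) / 2) * h

/-- A matrix commuting with `σ₃` has vanishing `(1,0)` entry. [folklore] -/
theorem apply10_eq_zero_of_commute_sigma3 {A : Matrix (Fin 2) (Fin 2) ℂ} (hA : Commute A σ₃) : A 1 0 = 0 := by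
  have h := congrFun (congrFun hA.eq 1) 0
  rw [sigma3_eq] at h
  simp [Matrix.mul_apply, Fin.sum_univ_two] at h
  linear_combination h / 2

/-- A matrix with vanishing off-diagonal entries commutes with `σ₃`. [folklore] -/
theorem commute_sigma3_of_apply_eq_zero {A : Matrix (Fin 2) (Fin 2) ℂ} (h01 : A 0 1 = 0) (h10 : A 1 0 = 0) : Commute A σ₃ := by
  rw [sigma3_eq]
  refine Matrix.ext fun i j => ?_
  rw [Matrix.mul_apply, Matrix.mul_apply]
  fin_cases i <;> fin_cases j <;> simp [Fin.sum_univ_two, h01, h10]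

/-- Two matrices commuting with `σ₃` commute with each other (both are diagonal). [folklore] -/
theorem commute_of_commute_sigma3 {A B : Matrix (Fin 2) (Fin 2) ℂ} (hA : Commute A σ₃) (hB : Commute B σ₃) : Commute A B := by
  have hA01 := apply01_eq_zero_of_commute_sigma3 hA
  have hA10 := apply10_eq_zero_of_commute_sigma3 hA
  have hB01 := apply01_eq_zero_of_commute_sigma3 hB
  have hB10 := apply10_eq_zero_of_commute_sigma3 hB
  refine Matrix.ext fun i j => ?_
  rw [Matrix.mul_apply, Matrix.mul_apply]
  fin_cases i <;> fin_cases j <;> simp [Fin.sum_univ_two, hA01, hA10, hB01, hB10] <;> ring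

/-- ★ **DIAGONAL AND COMMUTING WITH A NON-DIAGONAL MATRIX ⇒ CENTRAL**: if `D` commutes with `σ₃` and with some `c` that does NOT commute with `σ₃`, then `D`
commutes with every matrix (it is a scalar: `D₀₀c₀₁ = c₀₁D₁₁`, `D₁₁c₁₀ = c₁₀D₀₀` with `c₀₁ ≠ 0` or `c₁₀ ≠ 0`). [folklore] -/
theorem central_of_commute_sigma3_of_commute {D c : Matrix (Fin 2) (Fin 2) ℂ} (hD : Commute D σ₃) (hDc : Commute D c) (hc : ¬ Commute c σ₃) :
    ∀ M : Matrix (Fin 2) (Fin 2) ℂ, Commute D M := by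
  have hD01 := apply01_eq_zero_of_commute_sigma3 hD
  have hD10 := apply10_eq_zero_of_commute_sigma3 hD
  -- `c` has a non-zero off-diagonal entry
  have hoff : c 0 1 ≠ 0 ∨ c 1 0 ≠ 0 := by
    by_contra hno
    rw [not_or, not_not, not_not] at hno
    exact hc (commute_sigma3_of_apply_eq_zero hno.1 hno.2)
  -- the two diagonal entries of `D` agree
  have h01 := congrFun (congrFun hDc.eq 0) 1
  have h10 := congrFun (congrFun hDc.eq 1) 0
  simp only [Matrix.mul_apply, Fin.sum_univ_two, hD01, hD10, zero_mul, mul_zero, add_zero, zero_add] at h01 h10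
  have hdiag : D 0 0 = D 1 1 := by
    rcases hoff with h | h
    · exact mul_right_cancel₀ h (h01.trans (mul_comm _ _))
    · exact (mul_right_cancel₀ h (h10.trans (mul_comm _ _))).symm
  -- so `D` is a scalar
  have hDs : D = D 0 0 • (1 : Matrix (Fin 2) (Fin 2) ℂ) := by
    refine Matrix.ext fun i j => ?_
    fin_cases i <;> fin_cases j <;> simp [hD01, hD10, hdiag]
  intro M
  rw [hDs]
  exact (Commute.one_left M).smul_left _

/-- `σ₃` is self-adjoint. [folklore] -/
theorem star_sigma3 : star σ₃ = σ₃ := by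
  rw [sigma3_eq]
  refine Matrix.ext fun i j => ?_
  fin_cases i <;> fin_cases j <;> simp

end Matrices

/-! ## §2 Parallel sections and holonomies of a σ₃-diagonal field -/

section Diagonal

variable {P : Params} (V : GaugeField P 0 (Matrix.specialUnitaryGroup (Fin 2) ℂ))

/-- **HOLONOMIES OF A DIAGONAL FIELD ARE DIAGONAL**: if every bond variable commutes with `σ₃`, so does the holonomy along every walk. [cite: Balaban1985Averaging, (9) p.19] -/
theorem coe_holAt_walk_commute (hdiag : ∀ e : PBond P 0, Commute ((V e : Matrix.specialUnitaryGroup (Fin 2) ℂ) : Matrix (Fin 2) (Fin 2) ℂ) σ₃) :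
    ∀ (w : List (Letter P.d)) (x : Site P 0), Commute ((holAt V (walk x w) : Matrix.specialUnitaryGroup (Fin 2) ℂ) : Matrix (Fin 2) (Fin 2) ℂ) σ₃
  | [], x => by
    rw [show walk x ([] : List (Letter P.d)) = [] from rfl, holAt_nil]
    exact Commute.one_left _
  | (μ, true) :: w, x => by
    rw [show walk x ((μ, true) :: w) = ⟨⟨x, μ⟩, true⟩ :: walk (x.shift μ) w from rfl, holAt_cons]
    simp only [ite_true, Submonoid.coe_mul]
    exact (hdiag _).mul_left (coe_holAt_walk_commute hdiag w _)
  | (μ, false) :: w, x => by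
    rw [show walk x ((μ, false) :: w) = ⟨⟨x.unshift μ, μ⟩, false⟩ :: walk (x.unshift μ) w from rfl, holAt_cons]
    simp only [Bool.false_eq_true, ite_false, Submonoid.coe_mul]
    refine Commute.mul_left ?_ (coe_holAt_walk_commute hdiag w _)
    have h1 : (((V ⟨x.unshift μ, μ⟩)⁻¹ : Matrix.specialUnitaryGroup (Fin 2) ℂ) : Matrix (Fin 2) (Fin 2) ℂ) =
        star ((V ⟨x.unshift μ, μ⟩ : Matrix.specialUnitaryGroup (Fin 2) ℂ) : Matrix (Fin 2) (Fin 2) ℂ) := rfl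
    rw [h1]
    have h2 := commute_star_star.2 (hdiag ⟨x.unshift μ, μ⟩)
    rwa [star_sigma3] at h2

/-- ★★ **PARALLEL TRANSPORT ALONG A WALK**: a `V♭`-parallel section satisfies `c(x) = H·c(walkEnd x w)·H⋆` with `H` the holonomy of the walk `w` from `x`.
[cite: Balaban1985BackgroundPropagators, (3.21) p.394; Balaban1985Averaging, (9) p.19] -/
theorem parallel_transport_walk {c : Site P 0 → Matrix (Fin 2) (Fin 2) ℂ}
    (hc : ∀ e : PBond P 0, c e.src = ((unitsField (toUField V) e : (Matrix (Fin 2) (Fin 2) ℂ)ˣ) : Matrix (Fin 2) (Fin 2) ℂ) * c e.tgt *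
      (((unitsField (toUField V) e)⁻¹ : (Matrix (Fin 2) (Fin 2) ℂ)ˣ) : Matrix (Fin 2) (Fin 2) ℂ)) :
    ∀ (w : List (Letter P.d)) (x : Site P 0),
      c x = ((holAt V (walk x w) : Matrix.specialUnitaryGroup (Fin 2) ℂ) : Matrix (Fin 2) (Fin 2) ℂ) * c (walkEnd x w) *
        star ((holAt V (walk x w) : Matrix.specialUnitaryGroup (Fin 2) ℂ) : Matrix (Fin 2) (Fin 2) ℂ)
  | [], x => by
    rw [show walk x ([] : List (Letter P.d)) = [] from rfl, holAt_nil, show walkEnd x ([] : List (Letter P.d)) = x from rfl]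
    simp
  | (μ, true) :: w, x => by
    rw [show walk x ((μ, true) :: w) = ⟨⟨x, μ⟩, true⟩ :: walk (x.shift μ) w from rfl, holAt_cons,
      show walkEnd x ((μ, true) :: w) = walkEnd (x.shift μ) w from rfl]
    simp only [ite_true, Submonoid.coe_mul, star_mul]
    have h1 := (parallel_iff_star V c ⟨x, μ⟩).1 (hc ⟨x, μ⟩)
    rw [show (⟨x, μ⟩ : PBond P 0).src = x from rfl, show (⟨x, μ⟩ : PBond P 0).tgt = x.shift μ from rfl] at h1
    rw [h1, parallel_transport_walk hc w (x.shift μ)]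
    simp only [mul_assoc]
  | (μ, false) :: w, x => by
    rw [show walk x ((μ, false) :: w) = ⟨⟨x.unshift μ, μ⟩, false⟩ :: walk (x.unshift μ) w from rfl, holAt_cons,
      show walkEnd x ((μ, false) :: w) = walkEnd (x.unshift μ) w from rfl]
    simp only [Bool.false_eq_true, ite_false, Submonoid.coe_mul, star_mul]
    have hb : (((V ⟨x.unshift μ, μ⟩)⁻¹ : Matrix.specialUnitaryGroup (Fin 2) ℂ) : Matrix (Fin 2) (Fin 2) ℂ) =
        star ((V ⟨x.unshift μ, μ⟩ : Matrix.specialUnitaryGroup (Fin 2) ℂ) : Matrix (Fin 2) (Fin 2) ℂ) := rfl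
    have hVU : star ((V ⟨x.unshift μ, μ⟩ : Matrix.specialUnitaryGroup (Fin 2) ℂ) : Matrix (Fin 2) (Fin 2) ℂ) *
        ((V ⟨x.unshift μ, μ⟩ : Matrix.specialUnitaryGroup (Fin 2) ℂ) : Matrix (Fin 2) (Fin 2) ℂ) = 1 :=
      Matrix.mem_unitaryGroup_iff'.1 (V ⟨x.unshift μ, μ⟩).2.1
    -- parallel at the bond `⟨x − e_μ, μ⟩`: `c(x − e_μ) = V·c(x)·V⋆`, hence `c(x) = V⋆·c(x − e_μ)·V`
    have h1 := (parallel_iff_star V c ⟨x.unshift μ, μ⟩).1 (hc ⟨x.unshift μ, μ⟩)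
    rw [show (⟨x.unshift μ, μ⟩ : PBond P 0).src = x.unshift μ from rfl,
      show (⟨x.unshift μ, μ⟩ : PBond P 0).tgt = (x.unshift μ).shift μ from rfl, Site.shift_unshift] at h1
    have h2 : c x = star ((V ⟨x.unshift μ, μ⟩ : Matrix.specialUnitaryGroup (Fin 2) ℂ) : Matrix (Fin 2) (Fin 2) ℂ) * c (x.unshift μ) *
        ((V ⟨x.unshift μ, μ⟩ : Matrix.specialUnitaryGroup (Fin 2) ℂ) : Matrix (Fin 2) (Fin 2) ℂ) := by
      rw [h1]
      calc c x = (star ((V ⟨x.unshift μ, μ⟩ : Matrix.specialUnitaryGroup (Fin 2) ℂ) : Matrix (Fin 2) (Fin 2) ℂ) *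
              ((V ⟨x.unshift μ, μ⟩ : Matrix.specialUnitaryGroup (Fin 2) ℂ) : Matrix (Fin 2) (Fin 2) ℂ)) * c x *
            (star ((V ⟨x.unshift μ, μ⟩ : Matrix.specialUnitaryGroup (Fin 2) ℂ) : Matrix (Fin 2) (Fin 2) ℂ) *
              ((V ⟨x.unshift μ, μ⟩ : Matrix.specialUnitaryGroup (Fin 2) ℂ) : Matrix (Fin 2) (Fin 2) ℂ)) := by rw [hVU, one_mul, mul_one]
        _ = _ := by simp only [mul_assoc]
    rw [h2, hb, star_star, parallel_transport_walk hc w (x.unshift μ)]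
    simp only [mul_assoc]

/-- ★ **CASE A — POINTWISE DIAGONAL PARALLEL SECTIONS ARE CONSTANT**: for a diagonal `V`, a parallel section commuting with `σ₃` at every site satisfies
`c(e₋) = c(e₊)` (two diagonal matrices commute), hence is constant on the connected torus. [cite: Balaban1985BackgroundPropagators, (3.21) p.394] -/
theorem parallel_const_of_commute_sigma3 (hdiag : ∀ e : PBond P 0, Commute ((V e : Matrix.specialUnitaryGroup (Fin 2) ℂ) : Matrix (Fin 2) (Fin 2) ℂ) σ₃)
    {c : Site P 0 → Matrix (Fin 2) (Fin 2) ℂ}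
    (hc : ∀ e : PBond P 0, c e.src = ((unitsField (toUField V) e : (Matrix (Fin 2) (Fin 2) ℂ)ˣ) : Matrix (Fin 2) (Fin 2) ℂ) * c e.tgt *
      (((unitsField (toUField V) e)⁻¹ : (Matrix (Fin 2) (Fin 2) ℂ)ˣ) : Matrix (Fin 2) (Fin 2) ℂ))
    (hcd : ∀ y, Commute (c y) σ₃) : ∃ c₀ : Matrix (Fin 2) (Fin 2) ℂ, (∀ y, c y = c₀) ∧ Commute c₀ σ₃ := by
  refine ⟨c (ofT (0 : TT P 0)), fun y => const_of_shift_eq c (fun x μ => ?_) y, hcd _⟩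
  have h1 := hc ⟨x, μ⟩
  have hcomm : Commute ((unitsField (toUField V) ⟨x, μ⟩ : (Matrix (Fin 2) (Fin 2) ℂ)ˣ) : Matrix (Fin 2) (Fin 2) ℂ) (c (x.shift μ)) := by
    rw [coe_unitsField_toUField]
    exact commute_of_commute_sigma3 (hdiag _) (hcd _)
  rw [show (⟨x, μ⟩ : PBond P 0).src = x from rfl, show (⟨x, μ⟩ : PBond P 0).tgt = x.shift μ from rfl, hcomm.eq, mul_assoc,
    Units.mul_inv, mul_one] at h1
  exact h1.symm

/-- ★★ **CASE B — A NON-DIAGONAL PARALLEL VALUE FORCES CENTRAL HOLONOMIES**: for a diagonal `V` with a parallel section `c` whose value at `y₀` does NOT commute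
with `σ₃`, every closed-walk holonomy at `y₀` commutes with every matrix (it is diagonal and commutes with the non-diagonal `c(y₀)`). This is the `hcen` datum
of the Z2-NORMAL-FORM. [cite: Balaban1985BackgroundPropagators, (3.21) p.394; Balaban1985Averaging, (9) p.19] -/
theorem loopHol_central_of_parallel_nondiag (hdiag : ∀ e : PBond P 0, Commute ((V e : Matrix.specialUnitaryGroup (Fin 2) ℂ) : Matrix (Fin 2) (Fin 2) ℂ) σ₃)
    {c : Site P 0 → Matrix (Fin 2) (Fin 2) ℂ}
    (hc : ∀ e : PBond P 0, c e.src = ((unitsField (toUField V) e : (Matrix (Fin 2) (Fin 2) ℂ)ˣ) : Matrix (Fin 2) (Fin 2) ℂ) * c e.tgt *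
      (((unitsField (toUField V) e)⁻¹ : (Matrix (Fin 2) (Fin 2) ℂ)ˣ) : Matrix (Fin 2) (Fin 2) ℂ))
    {y₀ : Site P 0} (hy₀ : ¬ Commute (c y₀) σ₃) :
    ∀ w : List (Letter P.d), walkEnd y₀ w = y₀ →
      ∀ M : Matrix (Fin 2) (Fin 2) ℂ, Commute ((holAt V (walk y₀ w) : Matrix.specialUnitaryGroup (Fin 2) ℂ) : Matrix (Fin 2) (Fin 2) ℂ) M := by
  intro w hw
  have hH := coe_holAt_walk_commute V hdiag w y₀
  have ht := parallel_transport_walk V hc w y₀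
  rw [hw] at ht
  -- `c(y₀) = H c(y₀) H⋆` with `H` unitary ⇒ `H` commutes with `c(y₀)`
  have hHU : star ((holAt V (walk y₀ w) : Matrix.specialUnitaryGroup (Fin 2) ℂ) : Matrix (Fin 2) (Fin 2) ℂ) *
      ((holAt V (walk y₀ w) : Matrix.specialUnitaryGroup (Fin 2) ℂ) : Matrix (Fin 2) (Fin 2) ℂ) = 1 :=
    Matrix.mem_unitaryGroup_iff'.1 (holAt V (walk y₀ w)).2.1
  have hHc : Commute ((holAt V (walk y₀ w) : Matrix.specialUnitaryGroup (Fin 2) ℂ) : Matrix (Fin 2) (Fin 2) ℂ) (c y₀) := by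
    show _ * c y₀ = c y₀ * _
    calc ((holAt V (walk y₀ w) : Matrix.specialUnitaryGroup (Fin 2) ℂ) : Matrix (Fin 2) (Fin 2) ℂ) * c y₀
        = ((holAt V (walk y₀ w) : Matrix.specialUnitaryGroup (Fin 2) ℂ) : Matrix (Fin 2) (Fin 2) ℂ) * c y₀ *
            (star ((holAt V (walk y₀ w) : Matrix.specialUnitaryGroup (Fin 2) ℂ) : Matrix (Fin 2) (Fin 2) ℂ) *
              ((holAt V (walk y₀ w) : Matrix.specialUnitaryGroup (Fin 2) ℂ) : Matrix (Fin 2) (Fin 2) ℂ)) := by rw [hHU, mul_one]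
      _ = (((holAt V (walk y₀ w) : Matrix.specialUnitaryGroup (Fin 2) ℂ) : Matrix (Fin 2) (Fin 2) ℂ) * c y₀ *
            star ((holAt V (walk y₀ w) : Matrix.specialUnitaryGroup (Fin 2) ℂ) : Matrix (Fin 2) (Fin 2) ℂ)) *
              ((holAt V (walk y₀ w) : Matrix.specialUnitaryGroup (Fin 2) ℂ) : Matrix (Fin 2) (Fin 2) ℂ) := by simp only [mul_assoc]
      _ = c y₀ * ((holAt V (walk y₀ w) : Matrix.specialUnitaryGroup (Fin 2) ℂ) : Matrix (Fin 2) (Fin 2) ℂ) := by rw [← ht]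
  exact central_of_commute_sigma3_of_commute hH hHc hy₀

/-- ★★★ **THE DICHOTOMY INSIDE THE DIAGONAL STRATUM**: for a σ₃-diagonal `SU(2)` field on a torus lattice, EITHER every parallel section is a CONSTANT diagonal
matrix (the `hPar` input of ✓`hLift_of_parallelConstCommuting`), OR at some site every closed-walk holonomy is central (the `hcen` input of the Z2-NORMAL-FORM).
[cite: Balaban1985BackgroundPropagators, (3.21) p.394; Balaban1985Averaging, (9) p.19] -/
theorem parallelConstDiag_or_loopHol_central (hdiag : ∀ e : PBond P 0, Commute ((V e : Matrix.specialUnitaryGroup (Fin 2) ℂ) : Matrix (Fin 2) (Fin 2) ℂ) σ₃) :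
    (∀ c : Site P 0 → Matrix (Fin 2) (Fin 2) ℂ,
      (∀ e : PBond P 0, c e.src = ((unitsField (toUField V) e : (Matrix (Fin 2) (Fin 2) ℂ)ˣ) : Matrix (Fin 2) (Fin 2) ℂ) * c e.tgt *
        (((unitsField (toUField V) e)⁻¹ : (Matrix (Fin 2) (Fin 2) ℂ)ˣ) : Matrix (Fin 2) (Fin 2) ℂ)) →
      ∃ c₀ : Matrix (Fin 2) (Fin 2) ℂ, (∀ y, c y = c₀) ∧ Commute c₀ σ₃) ∨
    ∃ y₀ : Site P 0, ∀ w : List (Letter P.d), walkEnd y₀ w = y₀ →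
      ∀ M : Matrix (Fin 2) (Fin 2) ℂ, Commute ((holAt V (walk y₀ w) : Matrix.specialUnitaryGroup (Fin 2) ℂ) : Matrix (Fin 2) (Fin 2) ℂ) M := by
  by_cases hA : ∀ c : Site P 0 → Matrix (Fin 2) (Fin 2) ℂ,
      (∀ e : PBond P 0, c e.src = ((unitsField (toUField V) e : (Matrix (Fin 2) (Fin 2) ℂ)ˣ) : Matrix (Fin 2) (Fin 2) ℂ) * c e.tgt *
        (((unitsField (toUField V) e)⁻¹ : (Matrix (Fin 2) (Fin 2) ℂ)ˣ) : Matrix (Fin 2) (Fin 2) ℂ)) → ∀ y, Commute (c y) σ₃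
  · exact Or.inl fun c hc => parallel_const_of_commute_sigma3 V hdiag hc (hA c hc)
  · obtain ⟨c, hc'⟩ := not_forall.1 hA
    obtain ⟨hc, hy⟩ := Classical.not_imp.1 hc'
    obtain ⟨y₀, hy₀⟩ := not_forall.1 hy
    exact Or.inr ⟨y₀, loopHol_central_of_parallel_nondiag V hdiag hc hy₀⟩

end Diagonal

/-! ## §3 T³: the fine-level bridge to `hLift_of_parallelConstCommuting` -/

section T3

variable (F : T3Family) {n K : ℕ}

/-- ★★ **`hLift` FOR A DIAGONAL FINE FIELD OVER A CASE-A COARSE FIELD.**  If `U₁ ∈ fibre V′` is printed-regular (`10⁷L³ε₀ ≤ 1`) with σ₃-commuting bond variables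
and every `V′♭`-parallel section is a constant commuting with `σ₃`, then `hLift U₁`: an `Ū₁`-parallel coarse section read through the level identification is
`V′♭`-parallel (✓`descendTo_eq_fieldShift_emlIterU_of_regPr`), hence a constant diagonal `c₀`, which commutes with every (diagonal) `U₁♭(b)` — the `hPar` of
✓`hLift_of_parallelConstCommuting`. [cite: Balaban1985BackgroundPropagators, (3.21) p.394; Balaban1987RG1, (0.4) p.253] -/
theorem hLift_of_mem_fibre_of_parallelConstDiag (h : n ≤ K) {ε₀ : ℝ} (hε₀ : 0 < ε₀) (hε : 10 ^ 7 * (F.L : ℝ) ^ 3 * ε₀ ≤ 1)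
    {V' : GaugeField (F.P n) 0 (Matrix.specialUnitaryGroup (Fin 2) ℂ)} {U₁ : GaugeField (F.P K) 0 (Matrix.specialUnitaryGroup (Fin 2) ℂ)}
    (hfib : U₁ ∈ fibre F ℰp n K h V') (hreg : RegPr F n K ε₀ U₁)
    (hU₁ : ∀ b : PBond (F.P K) 0, Commute ((U₁ b : Matrix.specialUnitaryGroup (Fin 2) ℂ) : Matrix (Fin 2) (Fin 2) ℂ) σ₃)
    (hA : ∀ c : Site (F.P n) 0 → Matrix (Fin 2) (Fin 2) ℂ,
      (∀ e : PBond (F.P n) 0, c e.src = ((unitsField (toUField V') e : (Matrix (Fin 2) (Fin 2) ℂ)ˣ) : Matrix (Fin 2) (Fin 2) ℂ) * c e.tgt *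
        (((unitsField (toUField V') e)⁻¹ : (Matrix (Fin 2) (Fin 2) ℂ)ˣ) : Matrix (Fin 2) (Fin 2) ℂ)) →
      ∃ c₀ : Matrix (Fin 2) (Fin 2) ℂ, (∀ y, c y = c₀) ∧ Commute c₀ σ₃) :
    ∀ cf : Site (F.P K) (K - n) → Matrix (Fin 2) (Fin 2) ℂ,
      (∀ e : PBond (F.P K) (K - n), cf e.src = ((emlIterU (K - n) (bgUnits F K U₁) e : (Matrix (Fin 2) (Fin 2) ℂ)ˣ) : Matrix (Fin 2) (Fin 2) ℂ) * cf e.tgt *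
        (((emlIterU (K - n) (bgUnits F K U₁) e)⁻¹ : (Matrix (Fin 2) (Fin 2) ℂ)ˣ) : Matrix (Fin 2) (Fin 2) ℂ)) →
      ∃ l₀ : Site (F.P K) 0 → Matrix (Fin 2) (Fin 2) ℂ,
        (∀ b' : PBond (F.P K) 0, l₀ b'.src = ((bgUnits F K U₁ b' : (Matrix (Fin 2) (Fin 2) ℂ)ˣ) : Matrix (Fin 2) (Fin 2) ℂ) * l₀ b'.tgt * (((bgUnits F K U₁ b')⁻¹ : (Matrix (Fin 2) (Fin 2) ℂ)ˣ) : Matrix (Fin 2) (Fin 2) ℂ)) ∧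
        ∀ y : Site (F.P K) (K - n), l₀ (embIter (K - n) y) = cf y := by
  -- the descent read in the units: `V′♭ = fieldShift hs (Ū₁♭)`
  have hV : (descendTo F ℰp n K h U₁ : GaugeField (F.P n) 0 (Matrix.specialUnitaryGroup (Fin 2) ℂ)) = V' := hfib
  have key := descendTo_eq_fieldShift_emlIterU_of_regPr F h hε₀ hε hreg
  rw [hV] at key
  obtain ⟨hs, key'⟩ : ∃ hs : (F.PP F.m n).sitesPerDir 0 = (F.PP F.m K).sitesPerDir (K - n),
      unitsField (toUField V') = fieldShift hs (emlIterU (K - n) (bgUnits F K U₁)) := ⟨_, key⟩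
  refine hLift_of_parallelConstCommuting F U₁ fun cf hpar => ?_
  -- the coarse section read on the comparison lattice is `V′♭`-parallel, hence a constant diagonal
  obtain ⟨c₀, hc₀, hcσ⟩ := hA (fun y => cf (siteShift hs y)) fun b' => by
    have hp := hpar (bondShift hs b')
    have hsrc : @PBond.src (F.P K) (K - n) (bondShift hs b') = siteShift hs b'.src := bondShift_src hs b'
    have htgt : @PBond.tgt (F.P K) (K - n) (bondShift hs b') = siteShift hs b'.tgt := bondShift_tgt hs b'
    rw [hsrc, htgt] at hp
    show cf (siteShift hs b'.src) = _ * cf (siteShift hs b'.tgt) * _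
    rw [hp, key', fieldShift_apply]
    rfl
  refine ⟨c₀, fun x => ?_, fun b => ?_⟩
  · have hx := hc₀ ((siteShift hs).symm x)
    simpa only [Equiv.apply_symm_apply] using hx
  · have hb : ((bgUnits F K U₁ b : (Matrix (Fin 2) (Fin 2) ℂ)ˣ) : Matrix (Fin 2) (Fin 2) ℂ) = ((U₁ b : Matrix.specialUnitaryGroup (Fin 2) ℂ) : Matrix (Fin 2) (Fin 2) ℂ) :=
      coe_unitsField_toUField U₁ b
    rw [hb]
    exact commute_of_commute_sigma3 hcσ (hU₁ b)

end T3

end Summit.QuantumFields.YangMills.Theorems.Prop7NestedMeanParallelLiftDiagGauge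

end
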